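import Literature.Computability.Complexity.NPClosureProofs
import Literature.Computability.Complexity.CookReducibilityTransitive
import HarnessLib

/-!
# Every level `Σₖᵖ,ᴼ` of the relativized polynomial hierarchy is closed under Karp reductions; polynomially bounded string quantifiers inside `PH^O`

Toolkit continuing `NPClosureProofs.lean` (the unrelativized `SigmaP_closure`) for the hierarchy
`SigmaPRel O k = sigmaP (PRel O) k` relative to an oracle `O` (`PolyHierarchy.lean`): the
routine closure properties behind "clearly `L_A ∈ Σₖ^{P,A}`" statements about diagonal oracle
languages (Ko 1989, §4.2; Furst–Saxe–Sipser 1984 / Baker–Gill–Solovay 1975: the upper-bound half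
of the `PH`-vs-`AC⁰` connection), obtained WITHOUT writing a machine:

* `preimage_mem_PRel`, `inter_P_mem_PRel`, `union_P_mem_PRel` — `P^O` is closed under
  polynomial-time preimages (Karp ⇒ Cook, `PolyTimeKarpReducible.turing_holds`, and
  `P^{P^O} = P^O`, `mem_PRel_of_polyTimeTuringReducible_holds`) and under `∩`/`∪` with `P`
  languages (the generic `inter_mem_of_preimage_closed`/`union_mem_of_preimage_closed` of
  `StringCopy.lean` with `P ⊆ P^O`);
* `SigmaPRel_closure` — for every `k`, `Σₖᵖ,ᴼ` is closed under polynomial-time preimages and under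
  `∩`/`∪` with `P` languages (the induction of `SigmaP_closure` verbatim, from the three base
  facts); corollaries `preimage_mem_SigmaPRel`, `preimage_mem_PiPRel`, `inter_P_mem_SigmaPRel`,
  `union_P_mem_SigmaPRel`, `P_subset_SigmaPRel`, `PiPRel_subset_SigmaPRel_succ`
  (`Πₖᵖ,ᴼ ⊆ Σₖ₊₁ᵖ,ᴼ`, dummy witness), `SigmaPRel_subset_PiPRel_succ`;
* the **polynomially bounded string quantifiers** on languages
  `bexStr p A = {x | ∃ y, |y| ≤ p(|x|) ∧ ⟨x, y⟩ ∈ A}` and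
  `ballStr p A = {x | ∀ y, |y| ≤ p(|x|) → ⟨x, y⟩ ∈ A}` (the language-level form of the class
  operators `polyExists`/`polyForall` of `Nondeterministic.lean`: `bexStr_mem_polyExists`,
  `compl_ballStr`), and **`bexStr_mem_SigmaPRel_add_two`, `ballStr_mem_SigmaPRel_add_two`**:
  for `A ∈ Σₖᵖ,ᴼ` both are in `Σₖ₊₂ᵖ,ᴼ` (one level is wasted on purpose so that the statement is
  uniform in the parity); hence **`bexStr_mem_PHRel`, `ballStr_mem_PHRel`, `inter_P_mem_PHRel`,
  `union_P_mem_PHRel`, `preimage_mem_PHRel`, `PRel_subset_PHRel`**: `PH^O` is closed under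
  polynomially bounded string quantification, Boolean combinations with `P` languages and Karp
  reductions — the form in which "a predicate with `d` alternating polynomially bounded
  quantifiers over a `P^O` matrix is in `PH^O`" is consumed (e.g. by the diagonal languages
  `Sipser_d ∘ OR` of Aaronson–Chen 2017, §5.4, `Literature/Barriers/QuantumAdvantage/AaronsonChenPH.lean`).

## References

* T. Baker, J. Gill, R. Solovay, *Relativizations of the P =? NP question*, SIAM J. Comput. 4
  (1975), §1 (relativized classes and their elementary closure properties).
* L. J. Stockmeyer, *The polynomial-time hierarchy*, Theoret. Comput. Sci. 3 (1976), §3–4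
  (`Σₖ` via bounded quantifiers, relativized form).
* S. Arora, B. Barak, *Computational Complexity: A Modern Approach*, CUP 2009, Def. 5.3,
  Thm. 2.8, §5.5.
* K.-I Ko, *Constructing oracles by lower bound techniques for circuits* (1989), §4.2.
-/

namespace Literature.Computability.Complexity

open _root_.Computability Polynomial

/-! ### `P^O`: preimages, intersections and unions with `P` languages -/

/-- **`P^O` is closed under polynomial-time preimages** (a Karp reduction is a Cook reduction,
and `P^{P^O} = P^O`). [cite: LadnerLynchSelman1975, §2] -/
theorem preimage_mem_PRel {O : Oracle} {L : Language Bool} (hL : L ∈ PRel O)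
    {f : List Bool → List Bool} (hf : f ∈ FP) : f ⁻¹' L ∈ PRel O :=
  mem_PRel_of_polyTimeTuringReducible_holds
    (PolyTimeKarpReducible.turing_holds ⟨f, hf, fun _ => Iff.rfl⟩) hL

/-- `P^O` absorbs intersections with `P` languages. [cite: BakerGillSolovay1975, §1] -/
theorem inter_P_mem_PRel {O : Oracle} {L₁ L₂ : Language Bool} (h₁ : L₁ ∈ Classes.P)
    (h₂ : L₂ ∈ PRel O) : L₁ ⊓ L₂ ∈ PRel O :=
  inter_mem_of_preimage_closed (fun _ hL _ hg => preimage_mem_PRel hL hg) (P_subset_PRel_holds O)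
    h₁ h₂

/-- `P^O` absorbs unions with `P` languages. [cite: BakerGillSolovay1975, §1] -/
theorem union_P_mem_PRel {O : Oracle} {L₁ L₂ : Language Bool} (h₁ : L₁ ∈ Classes.P)
    (h₂ : L₂ ∈ PRel O) : L₁ ⊔ L₂ ∈ PRel O :=
  union_mem_of_preimage_closed (fun _ hL _ hg => preimage_mem_PRel hL hg) (P_subset_PRel_holds O)
    h₁ h₂

/-! ### The levels `Σₖᵖ,ᴼ` -/

/-- **Closure properties of `Σₖᵖ,ᴼ`** (simultaneous induction on `k`, as for `SigmaP_closure`):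
closed under polynomial-time preimages, and under intersections and unions with `P` languages.
[cite: Stockmeyer1976, §3] -/
theorem SigmaPRel_closure (O : Oracle) (k : ℕ) :
    (∀ ⦃L : Language Bool⦄, L ∈ SigmaPRel O k →
        ∀ ⦃g : List Bool → List Bool⦄, g ∈ FP → g ⁻¹' L ∈ SigmaPRel O k) ∧
    (∀ ⦃L₁ L₂ : Language Bool⦄, L₁ ∈ Classes.P → L₂ ∈ SigmaPRel O k → L₁ ⊓ L₂ ∈ SigmaPRel O k) ∧
    (∀ ⦃L₁ L₂ : Language Bool⦄, L₁ ∈ Classes.P → L₂ ∈ SigmaPRel O k → L₁ ⊔ L₂ ∈ SigmaPRel O k) := by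
  induction k with
  | zero =>
    exact ⟨fun _ hL _ hg => preimage_mem_PRel hL hg, fun _ _ h₁ h₂ => inter_P_mem_PRel h₁ h₂,
      fun _ _ h₁ h₂ => union_P_mem_PRel h₁ h₂⟩
  | succ k ih =>
    obtain ⟨ihp, ihi, ihu⟩ := ih
    have cop : ∀ ⦃L : Language Bool⦄, L ∈ co (SigmaPRel O k) →
        ∀ ⦃g : List Bool → List Bool⦄, g ∈ FP → g ⁻¹' L ∈ co (SigmaPRel O k) :=
      fun _ hL _ hg => preimage_mem_co ihp hL hg
    have coi : ∀ ⦃L₁ L₂ : Language Bool⦄, L₁ ∈ Classes.P → L₂ ∈ co (SigmaPRel O k) →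
        L₁ ⊓ L₂ ∈ co (SigmaPRel O k) :=
      fun _ _ h₁ h₂ => inter_P_mem_co ihu h₁ h₂
    have cou : ∀ ⦃L₁ L₂ : Language Bool⦄, L₁ ∈ Classes.P → L₂ ∈ co (SigmaPRel O k) →
        L₁ ⊔ L₂ ∈ co (SigmaPRel O k) :=
      fun _ _ h₁ h₂ => union_P_mem_co ihi h₁ h₂
    refine ⟨fun L hL g hg => ?_, fun L₁ L₂ h₁ h₂ => ?_, fun L₁ L₂ h₁ h₂ => ?_⟩
    · exact preimage_mem_polyExists cop coi hL hg
    · exact inter_P_mem_polyExists coi h₁ h₂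
    · exact union_P_mem_polyExists cou h₁ h₂

/-- **`Σₖᵖ,ᴼ` is closed under polynomial-time preimages.** [cite: Stockmeyer1976, §3] -/
theorem preimage_mem_SigmaPRel {O : Oracle} {k : ℕ} {L : Language Bool} (hL : L ∈ SigmaPRel O k)
    {f : List Bool → List Bool} (hf : f ∈ FP) : f ⁻¹' L ∈ SigmaPRel O k :=
  (SigmaPRel_closure O k).1 hL hf

/-- **`Πₖᵖ,ᴼ` is closed under polynomial-time preimages.** [cite: Stockmeyer1976, §3] -/
theorem preimage_mem_PiPRel {O : Oracle} {k : ℕ} {L : Language Bool} (hL : L ∈ PiPRel O k)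
    {f : List Bool → List Bool} (hf : f ∈ FP) : f ⁻¹' L ∈ PiPRel O k :=
  preimage_mem_co (SigmaPRel_closure O k).1 hL hf

/-- `Σₖᵖ,ᴼ` absorbs intersections with `P` languages. [cite: Stockmeyer1976, §3] -/
theorem inter_P_mem_SigmaPRel {O : Oracle} {k : ℕ} {L₁ L₂ : Language Bool} (h₁ : L₁ ∈ Classes.P)
    (h₂ : L₂ ∈ SigmaPRel O k) : L₁ ⊓ L₂ ∈ SigmaPRel O k :=
  (SigmaPRel_closure O k).2.1 h₁ h₂

/-- `Σₖᵖ,ᴼ` absorbs unions with `P` languages. [cite: Stockmeyer1976, §3] -/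
theorem union_P_mem_SigmaPRel {O : Oracle} {k : ℕ} {L₁ L₂ : Language Bool} (h₁ : L₁ ∈ Classes.P)
    (h₂ : L₂ ∈ SigmaPRel O k) : L₁ ⊔ L₂ ∈ SigmaPRel O k :=
  (SigmaPRel_closure O k).2.2 h₁ h₂

/-- `P ⊆ Σₖᵖ,ᴼ` for every `k` (`P ⊆ P^O`; then a dummy witness and a complement per level).
[cite: BakerGillSolovay1975, §1] -/
theorem P_subset_SigmaPRel (O : Oracle) (k : ℕ) : Classes.P ⊆ SigmaPRel O k := by
  induction k with
  | zero => exact P_subset_PRel_holds O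
  | succ k ih =>
    intro L hL
    refine mem_polyExists_of_fst ?_
    change ({w | (boolUnpair w).1 ∈ L} : Language Bool)ᶜ ∈ SigmaPRel O k
    exact ih (compl_mem_P_iff.2 (P_closed_boolUnpair_fst L hL))

/-- **`Πₖᵖ,ᴼ ⊆ Σₖ₊₁ᵖ,ᴼ = ∃ᵖ·Πₖᵖ,ᴼ`** (dummy witness; `Πₖᵖ,ᴼ` is closed under the first projection).
[cite: Stockmeyer1976, §3] -/
theorem PiPRel_subset_SigmaPRel_succ (O : Oracle) (k : ℕ) : PiPRel O k ⊆ SigmaPRel O (k + 1) :=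
  fun _ hL => mem_polyExists_of_fst (preimage_mem_PiPRel hL boolUnpairFst_mem_FP)

/-- `Σₖᵖ,ᴼ ⊆ Πₖ₊₁ᵖ,ᴼ` (complements of the previous inclusion). [cite: Stockmeyer1976, §3] -/
theorem SigmaPRel_subset_PiPRel_succ (O : Oracle) (k : ℕ) : SigmaPRel O k ⊆ PiPRel O (k + 1) := by
  intro L hL
  change Lᶜ ∈ SigmaPRel O (k + 1)
  refine PiPRel_subset_SigmaPRel_succ O k ?_
  change Lᶜᶜ ∈ SigmaPRel O k
  rwa [compl_compl]

/-! ### Polynomially bounded string quantifiers -/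

/-- **The bounded existential string quantifier on a language**:
`bexStr p A = {x | ∃ y, |y| ≤ p(|x|) ∧ ⟨x, y⟩ ∈ A}` (the language-level form of `polyExists`).
[cite: Stockmeyer1976, §3] -/
def bexStr (p : Polynomial ℕ) (A : Language Bool) : Language Bool :=
  {x | ∃ y : List Bool, y.length ≤ p.eval x.length ∧ boolPair x y ∈ A}

/-- **The bounded universal string quantifier on a language**:
`ballStr p A = {x | ∀ y, |y| ≤ p(|x|) → ⟨x, y⟩ ∈ A}` (the language-level form of `polyForall`).
[cite: Stockmeyer1976, §3] -/
def ballStr (p : Polynomial ℕ) (A : Language Bool) : Language Bool :=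
  {x | ∀ y : List Bool, y.length ≤ p.eval x.length → boolPair x y ∈ A}

/-- Membership in `bexStr` (definitional). [folklore] -/
@[simp] theorem mem_bexStr {p : Polynomial ℕ} {A : Language Bool} {x : List Bool} :
    x ∈ bexStr p A ↔ ∃ y : List Bool, y.length ≤ p.eval x.length ∧ boolPair x y ∈ A := Iff.rfl

/-- Membership in `ballStr` (definitional). [folklore] -/
@[simp] theorem mem_ballStr {p : Polynomial ℕ} {A : Language Bool} {x : List Bool} :
    x ∈ ballStr p A ↔ ∀ y : List Bool, y.length ≤ p.eval x.length → boolPair x y ∈ A := Iff.rfl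

/-- `(ballStr p A)ᶜ = bexStr p Aᶜ` (De Morgan). [folklore] -/
theorem compl_ballStr (p : Polynomial ℕ) (A : Language Bool) : (ballStr p A)ᶜ = bexStr p Aᶜ := by
  ext x
  change ¬ (∀ y : List Bool, y.length ≤ p.eval x.length → boolPair x y ∈ A) ↔
    ∃ y : List Bool, y.length ≤ p.eval x.length ∧ boolPair x y ∉ A
  push Not
  rfl

/-- `(bexStr p A)ᶜ = ballStr p Aᶜ` (De Morgan). [folklore] -/
theorem compl_bexStr (p : Polynomial ℕ) (A : Language Bool) : (bexStr p A)ᶜ = ballStr p Aᶜ := by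
  rw [← compl_compl (ballStr p Aᶜ), compl_ballStr, compl_compl]

/-- `bexStr p A ∈ ∃ᵖ·K` for `A ∈ K` (this is the definition of `polyExists`). [cite: Stockmeyer1976, §3] -/
theorem bexStr_mem_polyExists {K : Set (Language Bool)} {A : Language Bool} (hA : A ∈ K)
    (p : Polynomial ℕ) : bexStr p A ∈ polyExists K :=
  ⟨A, hA, p, fun _ => Iff.rfl⟩

/-- **`∃` over a `Σₖᵖ,ᴼ` language lands in `Σₖ₊₂ᵖ,ᴼ`** (`Σₖ ⊆ Πₖ₊₁`, `∃ᵖ·Πₖ₊₁ = Σₖ₊₂`; one level is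
deliberately wasted to keep the statement parity-free). [cite: Stockmeyer1976, §3] -/
theorem bexStr_mem_SigmaPRel_add_two {O : Oracle} {k : ℕ} {A : Language Bool}
    (hA : A ∈ SigmaPRel O k) (p : Polynomial ℕ) : bexStr p A ∈ SigmaPRel O (k + 2) :=
  bexStr_mem_polyExists (SigmaPRel_subset_PiPRel_succ O k hA) p

/-- **`∀` over a `Σₖᵖ,ᴼ` language lands in `Σₖ₊₂ᵖ,ᴼ`** (`ballStr p A = (bexStr p Aᶜ)ᶜ ∈ Πₖ₊₁ ⊆ Σₖ₊₂`).
[cite: Stockmeyer1976, §3] -/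
theorem ballStr_mem_SigmaPRel_add_two {O : Oracle} {k : ℕ} {A : Language Bool}
    (hA : A ∈ SigmaPRel O k) (p : Polynomial ℕ) : ballStr p A ∈ SigmaPRel O (k + 2) := by
  refine PiPRel_subset_SigmaPRel_succ O (k + 1) ?_
  change (ballStr p A)ᶜ ∈ SigmaPRel O (k + 1)
  rw [compl_ballStr]
  refine bexStr_mem_polyExists ?_ p
  change Aᶜᶜ ∈ SigmaPRel O k
  rwa [compl_compl]

/-! ### `PH^O` -/

/-- `P^O ⊆ PH^O`. [cite: BakerGillSolovay1975, §1] -/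
theorem PRel_subset_PHRel (O : Oracle) : PRel O ⊆ PHRel O :=
  SigmaPRel_subset_PHRel O 0

/-- `P ⊆ PH^O`. [cite: BakerGillSolovay1975, §1] -/
theorem P_subset_PHRel (O : Oracle) : Classes.P ⊆ PHRel O :=
  (P_subset_PRel_holds O).trans (PRel_subset_PHRel O)

/-- **`PH^O` is closed under polynomially bounded existential string quantification.**
[cite: Stockmeyer1976, §3] -/
theorem bexStr_mem_PHRel {O : Oracle} {A : Language Bool} (hA : A ∈ PHRel O) (p : Polynomial ℕ) :
    bexStr p A ∈ PHRel O := by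
  obtain ⟨k, hk⟩ := Set.mem_iUnion.1 hA
  exact Set.mem_iUnion.2 ⟨k + 2, bexStr_mem_SigmaPRel_add_two hk p⟩

/-- **`PH^O` is closed under polynomially bounded universal string quantification.**
[cite: Stockmeyer1976, §3] -/
theorem ballStr_mem_PHRel {O : Oracle} {A : Language Bool} (hA : A ∈ PHRel O) (p : Polynomial ℕ) :
    ballStr p A ∈ PHRel O := by
  obtain ⟨k, hk⟩ := Set.mem_iUnion.1 hA
  exact Set.mem_iUnion.2 ⟨k + 2, ballStr_mem_SigmaPRel_add_two hk p⟩

/-- `PH^O` is closed under polynomial-time preimages. [cite: Stockmeyer1976, §3] -/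
theorem preimage_mem_PHRel {O : Oracle} {L : Language Bool} (hL : L ∈ PHRel O)
    {f : List Bool → List Bool} (hf : f ∈ FP) : f ⁻¹' L ∈ PHRel O := by
  obtain ⟨k, hk⟩ := Set.mem_iUnion.1 hL
  exact Set.mem_iUnion.2 ⟨k, preimage_mem_SigmaPRel hk hf⟩

/-- `PH^O` absorbs intersections with `P` languages. [cite: Stockmeyer1976, §3] -/
theorem inter_P_mem_PHRel {O : Oracle} {L₁ L₂ : Language Bool} (h₁ : L₁ ∈ Classes.P)
    (h₂ : L₂ ∈ PHRel O) : L₁ ⊓ L₂ ∈ PHRel O := by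
  obtain ⟨k, hk⟩ := Set.mem_iUnion.1 h₂
  exact Set.mem_iUnion.2 ⟨k, inter_P_mem_SigmaPRel h₁ hk⟩

/-- `PH^O` absorbs unions with `P` languages. [cite: Stockmeyer1976, §3] -/
theorem union_P_mem_PHRel {O : Oracle} {L₁ L₂ : Language Bool} (h₁ : L₁ ∈ Classes.P)
    (h₂ : L₂ ∈ PHRel O) : L₁ ⊔ L₂ ∈ PHRel O := by
  obtain ⟨k, hk⟩ := Set.mem_iUnion.1 h₂
  exact Set.mem_iUnion.2 ⟨k, union_P_mem_SigmaPRel h₁ hk⟩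

end Literature.Computability.Complexity
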